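import Summits.QuantumFields.YangMills.Theorems.ParabolicTrajectoryTunedSequenceExistsRPDiagonalQ

/-!
# Crux `TunedSequenceExists` (stmt-QuantumFields-10524): the RP-DIAGONAL VARIANT, part 2 —
# the `Q`-restated crux `(S_Q)` and its TWO-child split `(U_Q) → (V_Q) → (S_Q)` (no upper-bound child)

Part 1 (`…RPDiagonalQ`) shows that for the time-zero plaquette `Q = spatialPlaquette r` the
crux-format correlator `⟨Q ; τ_n Q⟩_{β,S}` is non-negative and antitone in `n` (landed reflection
positivity / transfer monotonicity), freezes as `β → ∞` and is `β`-continuous.  This part writes the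
text of conjunct (S) of route `ParabolicTrajectory` with `Q` in place of the corner action density
(`TunedSequenceExistsQ`), the two analogues `FemtoWindowQAll` (U_Q), `VolumeMonotoneQAll` (V_Q) of
the children of the registered line `fixed-aspect-window`, and the sorry-free glue
`tunedSequenceExistsQ_of : FemtoWindowQAll → VolumeMonotoneQAll → TunedSequenceExistsQ`: clause (iii)
of the crux (convergence of every `N_t`) needs NO canonical-upper-bound child for `Q` — it is squeezed
in `[0, N_1]` by RP (`windowQ_of_weak`).  Kernel-checked certificate of the planners' restatement
option (lead c3); obligation pieces of our crux, deliberately untagged (not published facts).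
-/

noncomputable section

open Filter Topology MeasureTheory
open Literature.MathematicalPhysics.QuantumFieldTheory Literature.MathematicalPhysics.QuantumLattice
open Summit.QuantumFields.YangMills.Theorems.TunedSequenceExists.Negative.AtZeroFalse
  (eventually_sep_le_L)

namespace Summit.QuantumFields.YangMills.Theorems.TunedSequenceExists.RPDiagonalVariant

variable {G : Type} [Group G] [TopologicalSpace G] [IsTopologicalGroup G] [CompactSpace G]
  [MeasurableSpace G] [BorelSpace G]

/-! ## The restated crux `(S_Q)` and its TWO-child split (no upper-bound child) -/

/-- **(U_Q)** — the pinned-aspect window for `Q` (same shape as stub `stub_femtoWindow`). -/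
def FemtoWindowQ (r : LatticeRep G) (M : ℕ) : Prop :=
  ∃ c : ℝ, 0 < c ∧ ∃ LU : ℕ, ∀ L₁ : ℕ, LU ≤ L₁ → 2 ≤ L₁ → ∀ (B : ℝ) (m₀ : ℕ),
    ∃ m : ℕ, m₀ ≤ m ∧ ∃ β : ℝ, B ≤ β ∧
      c / Real.log L₁ ^ 2 ≤ ((M : ℝ) ^ m) ^ 8 *
        latticeConnectedCorr r.ρ β (2 * (L₁ * M ^ m) + 1) (spatialPlaquette r) (spatialPlaquette r)
          (M ^ m)

/-- **(V_Q)** — one-sided volume quasi-monotonicity for `Q` (same shape as `stub_volumeMonotone`). -/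
def VolumeMonotoneQ (r : LatticeRep G) (M : ℕ) : Prop :=
  ∀ c : ℝ, 0 < c → ∃ LV : ℕ, ∀ L₁ : ℕ, LV ≤ L₁ → 2 ≤ L₁ → ∃ (β₁ : ℝ) (m₁ : ℕ),
    ∀ (β : ℝ) (m L : ℕ), β₁ ≤ β → m₁ ≤ m → L₁ * M ^ m ≤ L →
      ((M : ℝ) ^ m) ^ 8 *
          latticeConnectedCorr r.ρ β (2 * (L₁ * M ^ m) + 1) (spatialPlaquette r) (spatialPlaquette r)
            (M ^ m) - c / Real.log L₁ ^ 2 ≤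
      ((M : ℝ) ^ m) ^ 8 *
          latticeConnectedCorr r.ρ β (2 * L + 1) (spatialPlaquette r) (spatialPlaquette r) (M ^ m)

/-- **(S_Q)** — the crux text with the time-zero plaquette `Q` in place of the corner density `P`. -/
def TunedSequenceExistsQ : Prop :=
  ∀ (G : Type) [Group G] [TopologicalSpace G] [IsTopologicalGroup G] [CompactSpace G],
    IsCompactSimpleLieGroup G → letI : MeasurableSpace G := borel G
    haveI : BorelSpace G := ⟨rfl⟩
    ∀ (r : LatticeRep G) (M : ℕ), 2 ≤ M → ∃ θ₀ : ℝ, 0 < θ₀ ∧ ∀ θ : ℝ, 0 < θ → θ < θ₀ →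
      ∃ (sch : SpeciesScheme (YMSpecies G)) (n : ℕ → ℕ),
        (∀ k, sch.a k = ((M : ℝ) ^ n k)⁻¹) ∧ Tendsto sch.β atTop atTop ∧
        (∀ t : ℕ, 0 < t → ∃ c : ℝ, Tendsto (fun k => ((M : ℝ) ^ n k) ^ 8 *
            latticeConnectedCorr r.ρ (sch.β k) (sch.side k) (spatialPlaquette r)
              (spatialPlaquette r) (t * M ^ n k)) atTop (𝓝 c)) ∧
        Tendsto (fun k => ((M : ℝ) ^ n k) ^ 8 *
            latticeConnectedCorr r.ρ (sch.β k) (sch.side k) (spatialPlaquette r)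
              (spatialPlaquette r) (M ^ n k)) atTop (𝓝 θ)

/-- (U_Q) under the crux prefix. -/
def FemtoWindowQAll : Prop :=
  ∀ (G : Type) [Group G] [TopologicalSpace G] [IsTopologicalGroup G] [CompactSpace G],
    IsCompactSimpleLieGroup G → letI : MeasurableSpace G := borel G
    haveI : BorelSpace G := ⟨rfl⟩
    ∀ (r : LatticeRep G) (M : ℕ), 2 ≤ M → FemtoWindowQ r M

/-- (V_Q) under the crux prefix. -/
def VolumeMonotoneQAll : Prop :=
  ∀ (G : Type) [Group G] [TopologicalSpace G] [IsTopologicalGroup G] [CompactSpace G],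
    IsCompactSimpleLieGroup G → letI : MeasurableSpace G := borel G
    haveI : BorelSpace G := ⟨rfl⟩
    ∀ (r : LatticeRep G) (M : ℕ), 2 ≤ M → VolumeMonotoneQ r M

section GlueQ

/-- (U_Q) + (V_Q) ⇒ the window lower bound for `Q` (quantifier arithmetic, observable-agnostic). -/
theorem lowerBoundQ_of_femto_of_volume (r : LatticeRep G) {M : ℕ} (hU : FemtoWindowQ r M)
    (hV : VolumeMonotoneQ r M) :
    ∃ θ₀ : ℝ, 0 < θ₀ ∧ ∀ (B : ℝ) (m₀ L₀ : ℕ), ∃ m : ℕ, m₀ ≤ m ∧ ∃ L : ℕ, L₀ * M ^ m ≤ L ∧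
      ∃ β : ℝ, B ≤ β ∧ θ₀ ≤ ((M : ℝ) ^ m) ^ 8 *
        latticeConnectedCorr r.ρ β (2 * L + 1) (spatialPlaquette r) (spatialPlaquette r) (M ^ m) := by
  obtain ⟨c, hc, LU, hU⟩ := hU
  obtain ⟨LV, hV⟩ := hV (c / 2) (half_pos hc)
  set L₁ : ℕ := max (max LU LV) 2 with hL₁
  have hLU : LU ≤ L₁ := (le_max_left _ _).trans (le_max_left _ _)
  have hLV : LV ≤ L₁ := (le_max_right _ _).trans (le_max_left _ _)
  have h2 : 2 ≤ L₁ := le_max_right _ _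
  have hlog : 0 < Real.log (L₁ : ℝ) := Real.log_pos (by exact_mod_cast h2)
  obtain ⟨β₁, m₁, hV'⟩ := hV L₁ hLV h2
  refine ⟨c / 2 / Real.log L₁ ^ 2, by positivity, fun B m₀ L₀ => ?_⟩
  obtain ⟨m, hm, β, hβ, hu⟩ := hU L₁ hLU h2 (max B β₁) (max m₀ m₁)
  refine ⟨m, (le_max_left _ _).trans hm, max L₀ L₁ * M ^ m,
    Nat.mul_le_mul_right _ (le_max_left _ _), β, (le_max_left _ _).trans hβ, ?_⟩
  have hstep := hV' β m (max L₀ L₁ * M ^ m) ((le_max_right _ _).trans hβ)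
    ((le_max_right _ _).trans hm) (Nat.mul_le_mul_right _ (le_max_right _ _))
  have hhalf : c / 2 / Real.log (L₁ : ℝ) ^ 2 = c / Real.log L₁ ^ 2 - c / 2 / Real.log L₁ ^ 2 := by
    ring
  linarith

/-- Exact tuning at one lattice for `Q` (continuity + freezing + IVT). -/
theorem exists_ge_corrQ_eq (r : LatticeRep G) (M m L : ℕ) {θ θ₀ βstar : ℝ} (hθ : 0 < θ)
    (hθθ₀ : θ < θ₀) (hstar : θ₀ ≤ ((M : ℝ) ^ m) ^ 8 *
      latticeConnectedCorr r.ρ βstar (2 * L + 1) (spatialPlaquette r) (spatialPlaquette r) (M ^ m)) :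
    ∃ β : ℝ, βstar ≤ β ∧ ((M : ℝ) ^ m) ^ 8 *
      latticeConnectedCorr r.ρ β (2 * L + 1) (spatialPlaquette r) (spatialPlaquette r) (M ^ m) = θ := by
  set f : ℝ → ℝ := fun β => ((M : ℝ) ^ m) ^ 8 *
    latticeConnectedCorr r.ρ β (2 * L + 1) (spatialPlaquette r) (spatialPlaquette r) (M ^ m) with hf
  have hfc : Continuous f :=
    continuous_const.mul (continuous_latticeConnectedCorr_spatialPlaquette r (2 * L + 1) (M ^ m))
  have hlim : Tendsto f atTop (𝓝 0) := by
    have := (latticeConnectedCorr_spatialPlaquette_tendsto_zero r (2 * L + 1) (M ^ m)).const_mul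
      (((M : ℝ) ^ m) ^ 8)
    rwa [mul_zero] at this
  obtain ⟨β₂, hβ₂⟩ := eventually_atTop.1 ((hlim.eventually (gt_mem_nhds hθ)).and
    (eventually_ge_atTop βstar))
  obtain ⟨hlt, hge⟩ := hβ₂ β₂ le_rfl
  have hIVT := intermediate_value_Icc' hge hfc.continuousOn
  obtain ⟨β, hβmem, hβeq⟩ := hIVT ⟨hlt.le, by simpa [hf] using hθθ₀.le.trans hstar⟩
  exact ⟨β, hβmem.1, hβeq⟩

/-- Lower bound ⇒ a tuned `M`-adic witness with `β_k → ∞` and EXACT tuning `N_1(k) = θ`. -/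
theorem weakQ_of_lowerBound (r : LatticeRep G) {M : ℕ} (hM : 2 ≤ M)
    (h : ∃ θ₀ : ℝ, 0 < θ₀ ∧ ∀ (B : ℝ) (m₀ L₀ : ℕ), ∃ m : ℕ, m₀ ≤ m ∧ ∃ L : ℕ, L₀ * M ^ m ≤ L ∧
      ∃ β : ℝ, B ≤ β ∧ θ₀ ≤ ((M : ℝ) ^ m) ^ 8 *
        latticeConnectedCorr r.ρ β (2 * L + 1) (spatialPlaquette r) (spatialPlaquette r) (M ^ m)) :
    ∃ θ₀ : ℝ, 0 < θ₀ ∧ ∀ θ : ℝ, 0 < θ → θ < θ₀ →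
      ∃ (sch : SpeciesScheme (YMSpecies G)) (n : ℕ → ℕ),
        (∀ k, sch.a k = ((M : ℝ) ^ n k)⁻¹) ∧ Tendsto sch.β atTop atTop ∧
        Tendsto (fun k => ((M : ℝ) ^ n k) ^ 8 *
            latticeConnectedCorr r.ρ (sch.β k) (sch.side k) (spatialPlaquette r)
              (spatialPlaquette r) (M ^ n k)) atTop (𝓝 θ) := by
  obtain ⟨θ₀, hθ₀, h⟩ := h
  refine ⟨θ₀, hθ₀, fun θ hθ hθθ₀ => ?_⟩
  choose m hm L hL βs hβs hcorr using fun k : ℕ => h (k : ℝ) k k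
  choose β hββs hβeq using fun k : ℕ => exists_ge_corrQ_eq r M (m k) (L k) hθ hθθ₀ (hcorr k)
  have hM1 : (1 : ℝ) < M := by exact_mod_cast hM
  have hm_top : Tendsto m atTop atTop := tendsto_atTop_mono hm tendsto_id
  have hpow_top : Tendsto (fun k => (M : ℝ) ^ m k) atTop atTop :=
    (tendsto_pow_atTop_atTop_of_one_lt hM1).comp hm_top
  let sch : SpeciesScheme (YMSpecies G) :=
    { a := fun k => ((M : ℝ) ^ m k)⁻¹
      a_pos := fun k => by positivity
      tendsto_a := tendsto_inv_atTop_zero.comp hpow_top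
      β := β
      L := L
      tendsto_L := by
        refine tendsto_atTop_mono (fun k => ?_) tendsto_natCast_atTop_atTop
        have hLk : (k : ℝ) * (M : ℝ) ^ m k ≤ L k := by exact_mod_cast hL k
        have hp : (0 : ℝ) < (M : ℝ) ^ m k := by positivity
        show (k : ℝ) ≤ ((M : ℝ) ^ m k)⁻¹ * (L k : ℝ)
        rw [inv_mul_eq_div, le_div_iff₀ hp]
        exact hLk
      c := fun _ _ => 0
      m := fun _ _ => 0 }
  refine ⟨sch, m, fun k => rfl, ?_, ?_⟩
  · exact tendsto_atTop_mono (fun k => (hβs k).trans (hββs k)) tendsto_natCast_atTop_atTop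
  · exact tendsto_const_nhds.congr fun k => (hβeq k).symm

variable {ι : Type} in
/-- Re-indexing a scaling scheme along a strictly increasing map. -/
def reindexQ (sch : SpeciesScheme ι) (φ : ℕ → ℕ) (hφ : StrictMono φ) : SpeciesScheme ι where
  a := sch.a ∘ φ
  a_pos k := sch.a_pos (φ k)
  tendsto_a := sch.tendsto_a.comp hφ.tendsto_atTop
  β := sch.β ∘ φ
  L := sch.L ∘ φ
  tendsto_L := sch.tendsto_L.comp hφ.tendsto_atTop
  c s := sch.c s ∘ φ
  m s := sch.m s ∘ φ

/-- **Clause (iii) for `Q` is free**: along ANY tuned `M`-adic witness with `β_k → ∞`, every `N_t`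
is eventually squeezed in `[0, N_1]` (RP non-negativity + transfer monotonicity), hence bounded, hence
convergent along a diagonal subsequence — no upper-bound stub. -/
theorem windowQ_of_weak (r : LatticeRep G) (M : ℕ) (θ : ℝ) (sch : SpeciesScheme (YMSpecies G))
    (n : ℕ → ℕ) (hshape : ∀ k, sch.a k = ((M : ℝ) ^ n k)⁻¹) (hβ : Tendsto sch.β atTop atTop)
    (hlim : Tendsto (fun k => ((M : ℝ) ^ n k) ^ 8 *
        latticeConnectedCorr r.ρ (sch.β k) (sch.side k) (spatialPlaquette r) (spatialPlaquette r)
          (M ^ n k)) atTop (𝓝 θ)) :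
    ∃ (sch' : SpeciesScheme (YMSpecies G)) (n' : ℕ → ℕ),
      (∀ k, sch'.a k = ((M : ℝ) ^ n' k)⁻¹) ∧ Tendsto sch'.β atTop atTop ∧
      (∀ t : ℕ, 0 < t → ∃ c : ℝ, Tendsto (fun k => ((M : ℝ) ^ n' k) ^ 8 *
          latticeConnectedCorr r.ρ (sch'.β k) (sch'.side k) (spatialPlaquette r) (spatialPlaquette r)
            (t * M ^ n' k)) atTop (𝓝 c)) ∧
      Tendsto (fun k => ((M : ℝ) ^ n' k) ^ 8 *
          latticeConnectedCorr r.ρ (sch'.β k) (sch'.side k) (spatialPlaquette r) (spatialPlaquette r)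
            (M ^ n' k)) atTop (𝓝 θ) := by
  -- `u k t'` := N_{t'+1}(k)
  set u : ℕ → ℕ → ℝ := fun k t' => ((M : ℝ) ^ n k) ^ 8 *
    latticeConnectedCorr r.ρ (sch.β k) (sch.side k) (spatialPlaquette r) (spatialPlaquette r)
      ((t' + 1) * M ^ n k) with hu
  -- a global bound on `N_1`: convergent sequences are bounded
  obtain ⟨K, hK⟩ : ∃ K : ℝ, ∀ k, |((M : ℝ) ^ n k) ^ 8 *
      latticeConnectedCorr r.ρ (sch.β k) (sch.side k) (spatialPlaquette r) (spatialPlaquette r)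
        (M ^ n k)| ≤ K := by
    obtain ⟨K, hK⟩ := hlim.norm.isBoundedUnder_le
    obtain ⟨k₀, hk₀⟩ := eventually_atTop.1 hK
    refine ⟨max K (∑ j ∈ Finset.range k₀, |((M : ℝ) ^ n j) ^ 8 *
      latticeConnectedCorr r.ρ (sch.β j) (sch.side j) (spatialPlaquette r) (spatialPlaquette r)
        (M ^ n j)|), fun k => ?_⟩
    rcases lt_or_ge k k₀ with hk | hk
    · exact le_max_of_le_right (Finset.single_le_sum (f := fun j => |((M : ℝ) ^ n j) ^ 8 *
        latticeConnectedCorr r.ρ (sch.β j) (sch.side j) (spatialPlaquette r) (spatialPlaquette r)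
          (M ^ n j)|) (fun j _ => abs_nonneg _) (Finset.mem_range.2 hk))
    · exact le_max_of_le_left (by simpa [Real.norm_eq_abs] using hk₀ k hk)
  -- each `N_t` is bounded: eventually `0 ≤ N_t ≤ N_1 ≤ K`, finitely many early terms
  have hbdd : ∀ t' : ℕ, ∃ C : ℝ, ∀ k, |u k t'| ≤ C := by
    intro t'
    have hev : ∀ᶠ k in atTop, |u k t'| ≤ K := by
      filter_upwards [tendsto_atTop.1 hβ 0, eventually_sep_le_L sch hshape (t' + 1)] with k hk1 hk2
      have h0 := rescaled_nonneg r hk1 M (n k) (sch.L k) ((t' + 1) * M ^ n k)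
      have h1 := rescaled_mul_le r hk1 M (n k) (sch.L k) (t' + 1) (Nat.succ_pos t') (by omega)
      have h2 := (le_abs_self _).trans (hK k)
      simp only [hu, SpeciesScheme.side]
      rw [abs_of_nonneg h0]
      exact h1.trans h2
    obtain ⟨k₀, hk₀⟩ := eventually_atTop.1 hev
    refine ⟨max K (∑ j ∈ Finset.range k₀, |u j t'|), fun k => ?_⟩
    rcases lt_or_ge k k₀ with hk | hk
    · exact le_max_of_le_right
        (Finset.single_le_sum (fun j _ => abs_nonneg (u j t')) (Finset.mem_range.2 hk))
    · exact le_max_of_le_left (hk₀ k hk)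
  choose C hC using hbdd
  set Kset : Set (ℕ → ℝ) := Set.pi Set.univ fun t' => Set.Icc (-C t') (C t') with hKset
  have hKc : IsCompact Kset := isCompact_univ_pi fun t' => isCompact_Icc
  have huK : ∀ k, u k ∈ Kset := fun k => by
    simp only [hKset, Set.mem_pi, Set.mem_univ, true_implies, Set.mem_Icc]
    intro t'
    exact abs_le.1 (hC t' k)
  obtain ⟨lim, -, φ, hφ, hconv⟩ := hKc.tendsto_subseq huK
  refine ⟨reindexQ sch φ hφ, n ∘ φ, fun k => hshape (φ k), hβ.comp hφ.tendsto_atTop, ?_, ?_⟩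
  · intro t ht
    obtain ⟨t', rfl⟩ := Nat.exists_eq_succ_of_ne_zero ht.ne'
    refine ⟨lim t', ?_⟩
    have h1 : Tendsto (fun j => u (φ j) t') atTop (𝓝 (lim t')) := tendsto_pi_nhds.1 hconv t'
    refine h1.congr fun j => ?_
    simp only [hu, Function.comp_apply, Nat.succ_eq_add_one]
    rfl
  · exact hlim.comp hφ.tendsto_atTop

end GlueQ

/-- **The two-child split of the restated crux**: `(U_Q) → (V_Q) → (S_Q)`, sorry-free, with NO
canonical-upper-bound child — clause (iii) is discharged by reflection positivity
(`windowQ_of_weak`). -/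
theorem tunedSequenceExistsQ_of (hU : FemtoWindowQAll) (hV : VolumeMonotoneQAll) :
    TunedSequenceExistsQ := by
  intro G _ _ _ _ hG
  letI : MeasurableSpace G := borel G
  haveI : BorelSpace G := ⟨rfl⟩
  intro r M hM
  obtain ⟨θ₀, hθ₀, hweak⟩ :=
    weakQ_of_lowerBound r hM (lowerBoundQ_of_femto_of_volume r (hU G hG r M hM) (hV G hG r M hM))
  refine ⟨θ₀, hθ₀, fun θ hθ hθ' => ?_⟩
  obtain ⟨sch, n, hshape, hβ, hlim⟩ := hweak θ hθ hθ'
  exact windowQ_of_weak r M θ sch n hshape hβ hlim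

end Summit.QuantumFields.YangMills.Theorems.TunedSequenceExists.RPDiagonalVariant

end
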